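import Summits.HodgeConjecture.CorCM.GaloisTwiceOddExceptionalClasses
import HarnessLib

/-!
# Groups in which every element outside every proper subgroup of order `≥ 3` is an involution

COR-CM (cell `pub-hodgecm2`), binder seat b04 (gen 19), count-neutral claim GALOIS-TWICE-ODD, part VIII (pure group
theory for the classification of part IX; uses `card_le_two_mul_of_forall_mul_self_eq_one` of part V).  KERNEL ONLY:
theorems; no definition, no named fact, no `sorry`.  `HC_CM` is neither used nor claimed.

Part III produces a primitive degenerate CM type from any subgroup `V ≤ H = Gal(K/k)` with `3 ≤ |V| < |H|` and a
non-involution in `H ∖ V`.  This file determines the finite groups `H` ESCAPING that criterion: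

**Theorem (`dihedral_or_of_forall_mul_self_eq_one`).**  If every `y ∈ H ∖ V` satisfies `y² = 1` for every subgroup
`V ≤ H` with `3 ≤ |V|`, `V ≠ H`, then one of: (A) `H` has exponent `≤ 2`; (B) `|H| = 4`; (C) `|H|` is prime; (D) `H`
is DIHEDRAL of order `2p`, `p ≥ 3` prime — `r ∈ H` of order `p` and an involution `s ∈ H ∖ ⟨r⟩` with
`s r s⁻¹ = r⁻¹`, `|H| = 2p`.

Proof: a non-involution `h` (order `n ≥ 3`) generates `V = ⟨h⟩`; a divisor `3 ≤ d < n` of `n` is excluded by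
`V' = ⟨h^{n/d}⟩ ∌ h` (`exists_dvd_of_not_prime_ne_four`), so `n` is prime or `4`.  If `V = H` this is (B)/(C).
Otherwise all of `H ∖ V` consists of involutions, `|H| = 2n` (part V), the involutions invert `h`; `n = 4` is excluded
by the centraliser `{1, h², t, t h²} ∌ h` of an involution `t`, so `n = p` prime: (D).

## References

* [Dodson1984] B. Dodson, *The structure of Galois groups of CM-fields*, Trans. AMS 283 (1984), §4.1, §5.1.1 (the
  dihedral Galois groups among the `ρ`-structures of CM fields).
-/

namespace Summit.HodgeConjecture.CorCM.TwiceOdd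

open scoped Classical

/-! ## §1 Arithmetic and counting helpers -/

/-- A composite `n ≥ 3` other than `4` has a divisor `d` with `3 ≤ d < n`. [folklore] -/
theorem exists_dvd_of_not_prime_ne_four {n : ℕ} (h3 : 3 ≤ n) (hnp : ¬ n.Prime) (h4 : n ≠ 4) :
    ∃ d, d ∣ n ∧ 3 ≤ d ∧ d < n := by
  obtain ⟨a, han, ha2, han'⟩ := Nat.exists_dvd_of_not_prime2 (by omega) hnp
  by_cases ha3 : 3 ≤ a
  · exact ⟨a, han, ha3, han'⟩
  · have ha : a = 2 := by omega
    subst ha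
    obtain ⟨b, rfl⟩ := han
    exact ⟨b, Dvd.intro_left 2 rfl, by omega, by omega⟩

variable {G : Type*} [Group G] [Fintype G]

/-- Three distinct elements of a subgroup: `3 ≤ |C|`. [folklore] -/
theorem three_le_card_of_mem {C : Subgroup G} {a b d : G} (ha : a ∈ C) (hb : b ∈ C) (hd : d ∈ C) (hab : a ≠ b)
    (had : a ≠ d) (hbd : b ≠ d) : 3 ≤ Nat.card C := by
  have hcard : (Finset.univ.filter fun g : G => g ∈ C).card = Nat.card C := by
    rw [Nat.card_eq_fintype_card, ← Fintype.card_subtype]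
  rw [← hcard]
  have hsub : ({a, b, d} : Finset G) ⊆ Finset.univ.filter fun g : G => g ∈ C := by
    intro x hx
    simp only [Finset.mem_insert, Finset.mem_singleton] at hx
    simp only [Finset.mem_filter, Finset.mem_univ, true_and]
    rcases hx with rfl | rfl | rfl
    · exact ha
    · exact hb
    · exact hd
  have h3 : ({a, b, d} : Finset G).card = 3 := Finset.card_eq_three.2 ⟨a, b, d, hab, had, hbd, rfl⟩
  exact h3 ▸ Finset.card_le_card hsub

/-- `|⟨h^{n/d}⟩| = d` for `d ∣ n = ord h`, `d ≠ 0`. [folklore] -/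
theorem card_zpowers_pow_div {h : G} {n d : ℕ} (hn : orderOf h = n) (hd : d ∣ n) (hd0 : d ≠ 0) :
    Nat.card (Subgroup.zpowers (h ^ (n / d))) = d := by
  have hn0 : n ≠ 0 := by rw [← hn]; exact (orderOf_pos h).ne'
  have hnd : n / d ≠ 0 := (Nat.div_pos (Nat.le_of_dvd (Nat.pos_of_ne_zero hn0) hd) (Nat.pos_of_ne_zero hd0)).ne'
  rw [Nat.card_zpowers, orderOf_pow' h hnd, hn, Nat.gcd_eq_right (Nat.div_dvd_of_dvd hd), Nat.div_div_self hd hn0]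

/-! ## §2 The structure theorem -/

/-- **Every element outside every proper subgroup of order `≥ 3` is an involution ⟹ exponent `2`, or order `4`, or
prime order, or dihedral of order `2p` (`p ≥ 3` prime).** [folklore] -/
theorem dihedral_or_of_forall_mul_self_eq_one {H : Subgroup G}
    (hyp : ∀ V : Subgroup G, V ≤ H → 3 ≤ Nat.card V → V ≠ H → ∀ y ∈ H, y ∉ V → y * y = 1) :
    (∀ h ∈ H, h * h = 1) ∨ Nat.card H = 4 ∨ (Nat.card H).Prime ∨
      ∃ r ∈ H, ∃ s ∈ H, ∃ p : ℕ, p.Prime ∧ 3 ≤ p ∧ orderOf r = p ∧ s ∉ Subgroup.zpowers r ∧ s * s = 1 ∧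
        s * r * s⁻¹ = r⁻¹ ∧ Nat.card H = 2 * p := by
  by_cases hA : ∀ h ∈ H, h * h = 1
  · exact Or.inl hA
  push Not at hA
  obtain ⟨h, hhH, hh2⟩ := hA
  -- `h` has order `n ≥ 3`
  set n : ℕ := orderOf h with hn
  have hh1 : h ≠ 1 := by rintro rfl; exact hh2 (mul_one 1)
  have hn0 : 0 < n := orderOf_pos h
  have hn3 : 3 ≤ n := by
    by_contra hlt
    have hn12 : n = 1 ∨ n = 2 := by omega
    rcases hn12 with h1 | h2
    · exact hh1 (orderOf_eq_one_iff.1 h1)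
    · apply hh2
      rw [← pow_two, ← h2, hn, pow_orderOf_eq_one]
  set V : Subgroup G := Subgroup.zpowers h with hV
  have hVH : V ≤ H := by rw [hV, Subgroup.zpowers_le]; exact hhH
  have hVcard : Nat.card V = n := by rw [hV, Nat.card_zpowers]
  have hhV : h ∈ V := Subgroup.mem_zpowers h
  -- no divisor `3 ≤ d < n`
  have hnodiv : ∀ d, d ∣ n → 3 ≤ d → d < n → False := by
    intro d hd h3d hdn
    set V' : Subgroup G := Subgroup.zpowers (h ^ (n / d)) with hV'
    have hV'card : Nat.card V' = d := card_zpowers_pow_div hn.symm hd (by omega)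
    have hV'H : V' ≤ H := by rw [hV', Subgroup.zpowers_le]; exact H.pow_mem hhH _
    have hhV' : h ∉ V' := by
      intro hmem
      have hle : V ≤ V' := by rw [hV, Subgroup.zpowers_le]; exact hmem
      have := Subgroup.card_le_of_le hle
      rw [hVcard, hV'card] at this
      omega
    have hV'ne : V' ≠ H := fun heq => hhV' (heq ▸ hhH)
    exact hh2 (hyp V' hV'H (by omega) hV'ne h hhH hhV')
  by_cases hVeq : V = H
  · -- `H = ⟨h⟩` cyclic of order `n`
    have hHn : Nat.card H = n := by rw [← hVeq, hVcard]
    by_cases hnp : n.Prime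
    · exact Or.inr (Or.inr (Or.inl (hHn ▸ hnp)))
    by_cases hn4 : n = 4
    · exact Or.inr (Or.inl (hHn.trans hn4))
    obtain ⟨d, hd, h3d, hdn⟩ := exists_dvd_of_not_prime_ne_four hn3 hnp hn4
    exact (hnodiv d hd h3d hdn).elim
  · -- `V ≠ H`: all of `H ∖ V` are involutions, `|H| = 2n`
    have hinv : ∀ y ∈ H, y ∉ V → y * y = 1 := hyp V hVH (by omega) hVeq
    have hle := card_le_two_mul_of_forall_mul_self_eq_one hVH hhV hh2 hinv
    obtain ⟨k, hk⟩ : n ∣ Nat.card H := hVcard ▸ Subgroup.card_dvd_of_le hVH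
    have hk2 : k = 2 := by
      rw [hVcard, hk] at hle
      have hk1 : k ≠ 1 := by
        rintro rfl
        apply hVeq
        exact Subgroup.eq_of_le_of_card_ge hVH (by rw [hk, hVcard, mul_one])
      have hk0 : k ≠ 0 := by
        rintro rfl
        rw [mul_zero] at hk
        exact (Nat.card_pos (α := H)).ne' hk
      have : k ≤ 2 := by
        by_contra h
        have : n * 3 ≤ n * k := Nat.mul_le_mul_left n (by omega)
        omega
      omega
    have hH2 : Nat.card H = 2 * n := by rw [hk, hk2, mul_comm]
    obtain ⟨t, htH, htV⟩ := SetLike.exists_of_lt (lt_of_le_of_ne hVH hVeq)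
    have ht2 : t * t = 1 := hinv t htH htV
    have htinv : t⁻¹ = t := inv_eq_of_mul_eq_one_right ht2
    -- the involution `t` inverts `h`
    have hconj : t * h * t = h⁻¹ := by
      have hth : t * h ∉ V := fun hm => htV (by simpa using V.mul_mem hm (V.inv_mem hhV))
      have h1 := hinv (t * h) (H.mul_mem htH hhH) hth
      rw [← mul_assoc] at h1
      exact mul_eq_one_iff_eq_inv.1 h1
    by_cases hnp : n.Prime
    · -- (D) dihedral of order `2p`
      refine Or.inr (Or.inr (Or.inr ⟨h, hhH, t, htH, n, hnp, hn3, rfl, htV, ht2, ?_, hH2⟩))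
      rw [htinv, hconj]
    · exfalso
      by_cases hn4 : n = 4
      · -- `D₄`: the centraliser of `t` in `H` contains `1, t, h²` but not `h`
        set C : Subgroup G := H ⊓ Subgroup.centralizer ({t} : Set G) with hC
        have hmemC : ∀ x, x ∈ C ↔ x ∈ H ∧ t * x = x * t := fun x => by
          rw [hC, Subgroup.mem_inf, Subgroup.mem_centralizer_iff]
          simp only [Set.mem_singleton_iff, forall_eq]
        have hh4 : h ^ 4 = 1 := by rw [← hn4, hn, pow_orderOf_eq_one]
        have hh2t : t * h ^ 2 = h ^ 2 * t := by
          -- `t h² t = (t h t)(t h t) = h⁻² = h²`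
          have h1 : t * h ^ 2 * t = h ^ 2 := by
            calc t * h ^ 2 * t = t * h * t * (t * h * t) := by
                  rw [pow_two]; simp only [mul_assoc]; rw [← mul_assoc t t, ht2, one_mul]
              _ = h⁻¹ * h⁻¹ := by rw [hconj]
              _ = h ^ 2 := by
                  rw [← mul_inv_rev, ← pow_two, inv_eq_iff_mul_eq_one, ← pow_add, hh4]
          calc t * h ^ 2 = t * h ^ 2 * t * t := by rw [mul_assoc (t * h ^ 2), ht2, mul_one]
            _ = h ^ 2 * t := by rw [h1]
        have h1C : (1 : G) ∈ C := C.one_mem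
        have htC : t ∈ C := (hmemC t).2 ⟨htH, rfl⟩
        have hh2C : h ^ 2 ∈ C := (hmemC _).2 ⟨H.pow_mem hhH 2, hh2t⟩
        have hh2ne : h ^ 2 ≠ 1 := by rw [pow_two]; exact hh2
        have ht1 : t ≠ 1 := fun h0 => htV (h0 ▸ V.one_mem)
        have hth2 : t ≠ h ^ 2 := fun h0 => htV (h0 ▸ V.pow_mem hhV 2)
        have h3 : 3 ≤ Nat.card C := three_le_card_of_mem h1C htC hh2C ht1.symm hh2ne.symm hth2
        have hCH : C ≤ H := inf_le_left
        have hhC : h ∉ C := by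
          intro hmem
          have hcomm := ((hmemC h).1 hmem).2
          apply hh2
          -- `t h = h t` and `t h t = h⁻¹` give `h = h⁻¹`
          have : h = h⁻¹ := by rw [← hconj, hcomm, mul_assoc, ht2, mul_one]
          exact mul_eq_one_iff_eq_inv.2 this
        have hCne : C ≠ H := fun heq => hhC (heq ▸ hhH)
        exact hh2 (hyp C hCH h3 hCne h hhH hhC)
      · obtain ⟨d, hd, h3d, hdn⟩ := exists_dvd_of_not_prime_ne_four hn3 hnp hn4
        exact hnodiv d hd h3d hdn

end Summit.HodgeConjecture.CorCM.TwiceOdd
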